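import Summits.QuantumFields.BalabanUV.Beta.GAN24.DirichletExhaustionFamily
import Summits.QuantumFields.BalabanUV.Beta.GAN24.DirichletExhaustionSandwich
import Literature.MathematicalPhysics.QuantumFieldTheory.Balaban1983to89.B6KernelComposition

/-!
# `BalabanUV.Beta.GAN24.DirichletExhaustionCovariance` — binder row G-an2-4 / (CONV-C), part P2, PART 5: the END SOCKET for a
# (2.156)-SHAPED COVARIANCE FAMILY `C·(CᵀΔ_kC)_Λ⁻¹·Cᵀ` — (CONV-C) on every `Λ ⊆ Ω ⊆ ℤ^d` from FIVE named inputs on `(C, Δ_k)`,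
# explicit constants (unit b2b-balaban-gan24-p2, gen 1, v1)

HONEST FRAMING (cell contract, verbatim): «discharging `BetaPertH` makes Bałaban's UV stability UNCONDITIONAL — a real
constructive-QFT result; it is NOT the continuum limit and NOT the Clay problem.»  This file COMPOSES PARTS 1–3 into one END
theorem shaped like the first constituent of (CONV-C) (cell `BETA/AN2.md` §6, O-an2-2a: `𝒢^{(k)} = C^{(k)}(𝟙;·,·)`), read through
[Balaban1984PropagatorsII] (2.156) `C^{(k)}_Λ = C(C*Δ_kC)⁻¹C*`: for a FIXED exponentially bounded kernel `C` and a family `Δ_k` of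
symmetric, `k`-uniformly decaying unit-lattice operators with an OPERATOR step-rate `θ₀θ^k`, whose sandwiches `CᵀΔ_kC` are
`k`-uniformly coercive on `Ω` ((2.157)-shape, the ONE non-generic input), the covariance family
`k ↦ C·(CᵀΔ_kC)_Λ⁻¹·Cᵀ` satisfies `ConvC` on EVERY `Λ ⊆ Ω ⊆ ℤ^d` with constants displayed in `(d, N, c_C, c₀, δ, γ, θ₀)` and the
supplier's ratio `θ`.  The five inputs are a HYPOTHESIS SHAPE ([shape] `CovInput`), asserted of nothing; NO kernel of Bałaban's is
instantiated (the ℤ^d typing of his `C*Δ_kC` and of (2.157) is the cell's open item (I1)/(I2), GAPS G-gan24p2-1 (b)); the operator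
rate (I3) is in the tree for the (1.66) entry kernels (`T4Rate166StripDirect.latticeKernel_Gsym_rate2`, `θ = L⁻²`).  [folklore]
composition; discharges NOTHING of `BetaPertH`; NOT continuum, NOT Clay.  «not in print; our proof attempt».

ABSOLUTE RULE (cell, verbatim): «No internally-minted statement may enter as a cited fact. Every hypothesis is either
kernel-proved in this package or a verbatim quotation of a PUBLISHED theorem with page reference. The manuscript(s) under
audit are NOT citable for their own disputed steps — they are the thing under adjudication; programme-internal
(2001/route/tribunal) claims are never citable.»

PRINTED LOCATIONS (not hypotheses): [Balaban1984PropagatorsII] p. 250 (2.156)–(2.157) and «C is a short-ranged operator, so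
C*Δ_kC has the same exponential decay as Δ_k. Now we may apply the theory developed in Sect. 5 of [3] on unit lattice operators.
It gives us an exponential decay, and all the other properties, for the operator (C*Δ_kC)⁻¹, hence for C^{(k)}_Λ also.» (render
`b2b-balaban-ref1/pages/1984-cmp96-propagators-rt-II/…-p028-x2.png`; quotation as certified in `B6BondElimination`/`T4Cov2156Rate`).

## What this file proves (0 sorry; imports PARTS 2 and 3, and b06's `B6KernelComposition` for `latticeConst_pos` only)
* [shape] `CovInput Ω C Δ c_C c₀ δ γ θ₀ θ` — the five inputs: `|C| ≤ c_C e^{−δ|·|}`; `|Δ_k| ≤ c₀e^{−δ|·|}` and `Δ_k` symmetric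
  (all `k`); operator step-rate `OpClose ℤ^d (Δ k) (Δ (k+1)) (θ₀θ^k) δ`; (2.157)-shape coercivity `γ‖v‖² ≤ ⟨v, (CᵀΔ_kC)_Λ v⟩` for
  every finite `Λ ⊆ Ω`, uniformly in `k`.
* `opFamilyRate_inner`: the sandwiched family `k ↦ CᵀΔ_kC` inhabits PART 1's `OpFamilyRate Ω · γ (s·c₀) (δ/2) (s·θ₀) θ`,
  `s = sandwichConst d N c_C δ` (PART 3 for decay, symmetry and step; coercivity = the input).
* `convC_inner`: `ConvC (k ↦ (CᵀΔ_kC)_Λ⁻¹) (convConst …) δ⋆ θ` (PART 2's `convC_limInv`), `δ⋆ = deltaStar d N γ (s·c₀) (δ/2)`.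
* `cov C Δ Λ k := C·(CᵀΔ_kC)_Λ⁻¹·Cᵀ` (`sandwich (trK C) (limInv Λ (sandwich C (Δ k)))`) and the END theorem **`convC_cov`**:
  `ConvC (cov C Δ Λ) (s⋆·convConst …) (δ⋆/2) θ`, `s⋆ = sandwichConst d N c_C δ⋆` — for every `Λ ⊆ Ω`.
NOT CLAIMED: the inputs for Bałaban's objects; NOT summit progress.
-/

namespace Summit.QuantumFields.BalabanUV.Beta.GAN24.DirichletExhaustionCovariance

open Finset Real Filter Topology
open Literature.MathematicalPhysics.QuantumFieldTheory.Balaban1983to89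
open B4Sect5Proof (cStar deltaStar delta1 latticeConst latticeConst_nonneg cStar_pos deltaStar_pos delta1_le_quarter)
open B4Sect5Exhaustion (K toMat Hyp56Z limInv limInv_abs_le)
open Summit.QuantumFields.BalabanUV.Beta.GAN24.DirichletExhaustion
open Summit.QuantumFields.BalabanUV.Beta.GAN24.DirichletExhaustionFamily
open Summit.QuantumFields.BalabanUV.Beta.GAN24.DirichletExhaustionSandwich

noncomputable section

variable {d N : ℕ}

/-! ## §1 Elementary weakenings -/

/-- `OpClose` passes to sub-regions. -/
theorem opClose_mono {Ω Ω' : Set (Fin d → ℤ)} {A A' : K d N → K d N → ℝ} {ε δ₀ : ℝ} (h : OpClose Ω' A A' ε δ₀)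
    (hΩ : Ω ⊆ Ω') : OpClose Ω A A' ε δ₀ :=
  fun p q hp hq => h p q (hΩ hp) (hΩ hq)

/-- Weakening the rate of an exponential entry bound. -/
theorem bound_weaken {C : K d N → K d N → ℝ} {c δ δ' : ℝ} (hc : 0 ≤ c) (hδ' : δ' ≤ δ)
    (h : ∀ r p : K d N, |C r p| ≤ c * Real.exp (-(δ * dist r.1 p.1))) (r p : K d N) :
    |C r p| ≤ c * Real.exp (-(δ' * dist r.1 p.1)) := by
  refine (h r p).trans (mul_le_mul_of_nonneg_left ?_ hc)
  exact Real.exp_le_exp.mpr (by nlinarith [dist_nonneg (x := r.1) (y := p.1)])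

/-- `δ⋆ ≤ δ₀` (indeed `deltaStar = delta1/4 ≤ δ₀/16`). -/
theorem deltaStar_le (d N : ℕ) (γ₀ c₀ : ℝ) {δ₀ : ℝ} (hδ : 0 < δ₀) : deltaStar d N γ₀ c₀ δ₀ ≤ δ₀ := by
  unfold deltaStar
  have h := delta1_le_quarter d N γ₀ c₀ (δ₀ := δ₀)
  linarith

/-- `sandwichConst > 0` when `c_C ≠ 0`, `N ≥ 1`, `δ > 0`. -/
theorem sandwichConst_pos (d : ℕ) {N : ℕ} (hN : 0 < N) {cC δ : ℝ} (hcC : 0 < cC) (hδ : 0 < δ) :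
    0 < sandwichConst d N cC δ := by
  unfold sandwichConst
  have h1 := B6KernelComposition.latticeConst_pos d (half_pos hδ)
  have h2 : (0 : ℝ) < N := by exact_mod_cast hN
  positivity

/-- The transposed kernel `Cᵀ(p,q) = C(q,p)`. -/
def trK (C : K d N → K d N → ℝ) : K d N → K d N → ℝ := fun p q => C q p

/-- The transposed kernel obeys the same exponential bound. -/
theorem trK_bound {C : K d N → K d N → ℝ} {c δ : ℝ} (h : ∀ r p : K d N, |C r p| ≤ c * Real.exp (-(δ * dist r.1 p.1)))
    (r p : K d N) : |trK C r p| ≤ c * Real.exp (-(δ * dist r.1 p.1)) := by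
  unfold trK; rw [dist_comm]; exact h p r

/-! ## §2 The five inputs and the inner family `CᵀΔ_kC` -/

/-- [shape] **The five inputs of the covariance socket** for a fixed sandwich kernel `C` and an operator family `Δ_k` on
`ℤ^d × Fin N`: exponential bound on `C`; `k`-uniform exponential bound and symmetry of `Δ_k`; the OPERATOR step-rate
`|Δ_{k+1} − Δ_k| ≤ θ₀θ^k e^{−δ|·|}`; and the (2.157)-shaped `k`-uniform coercivity of the sandwiches `CᵀΔ_kC` on every finite
`Λ ⊆ Ω` (B4's quadratic-form reading of `A ≥ γI`).  Asserted of nothing. -/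
structure CovInput (Ω : Set (Fin d → ℤ)) (C : K d N → K d N → ℝ) (Δ : ℕ → K d N → K d N → ℝ)
    (cC c₀ δ γ θ₀ θ : ℝ) : Prop where
  hC : ∀ r p : K d N, |C r p| ≤ cC * Real.exp (-(δ * dist r.1 p.1))
  hΔ : ∀ k (r s : K d N), |Δ k r s| ≤ c₀ * Real.exp (-(δ * dist r.1 s.1))
  hΔsymm : ∀ k (r s : K d N), Δ k r s = Δ k s r
  hstep : ∀ k, OpClose (Set.univ : Set (Fin d → ℤ)) (Δ k) (Δ (k + 1)) (θ₀ * θ ^ k) δ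
  hcoer : ∀ k (Λ : Finset (Fin d → ℤ)), (↑Λ : Set (Fin d → ℤ)) ⊆ Ω →
    ∀ v : B4.Idx Λ N → ℝ, γ * ∑ p, v p ^ 2 ≤ ∑ p, v p * (toMat Λ (sandwich C (Δ k))).mulVec v p

section Inner

variable {Ω : Set (Fin d → ℤ)} {C : K d N → K d N → ℝ} {Δ : ℕ → K d N → K d N → ℝ} {cC c₀ δ γ θ₀ θ : ℝ}

/-- **The sandwiched family `k ↦ CᵀΔ_kC` inhabits PART 1's `OpFamilyRate`** with `(γ, s·c₀, δ/2, s·θ₀, θ)`,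
`s = sandwichConst d N c_C δ`: symmetry / decay / step from PART 3, coercivity = the input. -/
theorem opFamilyRate_inner (h : CovInput Ω C Δ cC c₀ δ γ θ₀ θ) (hδ : 0 < δ) (hcC : 0 ≤ cC) :
    OpFamilyRate Ω (fun k => sandwich C (Δ k)) γ (sandwichConst d N cC δ * c₀) (δ / 2)
      (sandwichConst d N cC δ * θ₀) θ where
  hyp56 k :=
    { symm := fun p q _ _ => sandwich_symm (h.hΔsymm k) p q
      coercive := h.hcoer k
      decay := fun p q _ _ => sandwich_decay hδ hcC h.hC (h.hΔ k) p q }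
  step k := opClose_mono (opClose_sandwich_family hδ hcC h.hC h.hΔ h.hstep k) (Set.subset_univ Ω)

/-- **(CONV-C) for the inner Dirichlet inverse family `k ↦ (CᵀΔ_kC)_Λ⁻¹`** (PART 2's `convC_limInv` on `opFamilyRate_inner`),
every `Λ ⊆ Ω`. -/
theorem convC_inner (h : CovInput Ω C Δ cC c₀ δ γ θ₀ θ) (hδ : 0 < δ) (hN : 0 < N) (hcC : 0 < cC) (hc₀ : 0 < c₀)
    (hγ : 0 < γ) (hθ₀ : 0 ≤ θ₀) (hθ : 0 ≤ θ) {Λ : Set (Fin d → ℤ)} (hΛ : Λ ⊆ Ω) :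
    ConvC (fun k => limInv Λ (sandwich C (Δ k)))
      (convConst d N γ (sandwichConst d N cC δ * c₀) (δ / 2) (sandwichConst d N cC δ * θ₀))
      (deltaStar d N γ (sandwichConst d N cC δ * c₀) (δ / 2)) θ := by
  have hs := sandwichConst_pos d hN hcC hδ
  exact convC_limInv hγ (by positivity) (half_pos hδ) (by positivity) hθ (opFamilyRate_inner h hδ hcC.le) hΛ

end Inner

/-! ## §3 The covariance family `C·(CᵀΔ_kC)_Λ⁻¹·Cᵀ` and the END theorem -/

/-- The (2.156)-shaped covariance family on `Λ`: `cov C Δ Λ k = C·(CᵀΔ_kC)_Λ⁻¹·Cᵀ`, i.e.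
`(p,q) ↦ Σ_{r,s} C(p,r)·(CᵀΔ_kC)_Λ⁻¹(r,s)·C(q,s)` with B4's Dirichlet-exhaustion inverse `limInv Λ`. -/
def cov (C : K d N → K d N → ℝ) (Δ : ℕ → K d N → K d N → ℝ) (Λ : Set (Fin d → ℤ)) (k : ℕ) : K d N → K d N → ℝ :=
  sandwich (trK C) (limInv Λ (sandwich C (Δ k)))

section End

variable {Ω : Set (Fin d → ℤ)} {C : K d N → K d N → ℝ} {Δ : ℕ → K d N → K d N → ℝ} {cC c₀ δ γ θ₀ θ : ℝ}

/-- A `ConvC` family sandwiched by a fixed kernel `D` (bounded at the family's rate) is again a `ConvC` family: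
constants `(sandwichConst(c_D, δ₄)·C₄, δ₄/2, θ)` (PART 3's `abs_sandwich_le`, `sandwich_sub`). -/
theorem convC_sandwich {D : K d N → K d N → ℝ} {X : ℕ → K d N → K d N → ℝ} {cD C₄ δ₄ : ℝ} (hδ₄ : 0 < δ₄)
    (hcD : 0 ≤ cD) (hD : ∀ r p : K d N, |D r p| ≤ cD * Real.exp (-(δ₄ * dist r.1 p.1))) (hX : ConvC X C₄ δ₄ θ) :
    ConvC (fun k => sandwich D (X k)) (sandwichConst d N cD δ₄ * C₄) (δ₄ / 2) θ := by
  refine ⟨fun k p q => abs_sandwich_le hδ₄ hcD hD (hX.1 k) p q, fun k p q => ?_⟩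
  have hsub := sandwich_sub hδ₄ hcD hD (hX.1 k) (hX.1 (k + 1)) p q
  simp only at hsub ⊢
  rw [hsub, mul_assoc (sandwichConst d N cD δ₄)]
  exact abs_sandwich_le hδ₄ hcD hD (fun r s => hX.2 k r s) p q

/-- **`convC_cov` — THE END SOCKET.**  Under the five inputs `CovInput Ω C Δ c_C c₀ δ γ θ₀ θ` (`N ≥ 1`, `c_C, c₀, δ, γ > 0`,
`θ₀, θ ≥ 0`), the (2.156)-shaped covariance family `k ↦ C·(CᵀΔ_kC)_Λ⁻¹·Cᵀ` satisfies (CONV-C) on EVERY `Λ ⊆ Ω ⊆ ℤ^d`: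
`ConvC (cov C Δ Λ) (s⋆·convConst d N γ (s·c₀) (δ/2) (s·θ₀)) (δ⋆/2) θ` with `s = sandwichConst d N c_C δ`,
`δ⋆ = deltaStar d N γ (s·c₀) (δ/2)`, `s⋆ = sandwichConst d N c_C δ⋆`, `convConst = max{cStar, rateConst·(s·θ₀)}` — all displayed
functions of `(d, N, c_C, c₀, δ, γ, θ₀)`; the ratio `θ` is the supplier's, unchanged. -/
theorem convC_cov (h : CovInput Ω C Δ cC c₀ δ γ θ₀ θ) (hδ : 0 < δ) (hN : 0 < N) (hcC : 0 < cC) (hc₀ : 0 < c₀)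
    (hγ : 0 < γ) (hθ₀ : 0 ≤ θ₀) (hθ : 0 ≤ θ) {Λ : Set (Fin d → ℤ)} (hΛ : Λ ⊆ Ω) :
    ConvC (cov C Δ Λ)
      (sandwichConst d N cC (deltaStar d N γ (sandwichConst d N cC δ * c₀) (δ / 2)) *
        convConst d N γ (sandwichConst d N cC δ * c₀) (δ / 2) (sandwichConst d N cC δ * θ₀))
      (deltaStar d N γ (sandwichConst d N cC δ * c₀) (δ / 2) / 2) θ := by
  have hs := sandwichConst_pos d hN hcC hδ
  have hδs : 0 < deltaStar d N γ (sandwichConst d N cC δ * c₀) (δ / 2) :=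
    deltaStar_pos d N hγ (by positivity) (half_pos hδ)
  have hle : deltaStar d N γ (sandwichConst d N cC δ * c₀) (δ / 2) ≤ δ :=
    (deltaStar_le d N γ _ (half_pos hδ)).trans (by linarith)
  have hD : ∀ r p : K d N, |trK C r p| ≤
      cC * Real.exp (-(deltaStar d N γ (sandwichConst d N cC δ * c₀) (δ / 2) * dist r.1 p.1)) :=
    bound_weaken hcC.le hle (trK_bound h.hC)
  exact convC_sandwich hδs hcC.le hD (convC_inner h hδ hN hcC hc₀ hγ hθ₀ hθ hΛ)

/-- The UNIFORM clause of `convC_cov`, displayed. -/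
theorem cov_uniform (h : CovInput Ω C Δ cC c₀ δ γ θ₀ θ) (hδ : 0 < δ) (hN : 0 < N) (hcC : 0 < cC) (hc₀ : 0 < c₀)
    (hγ : 0 < γ) (hθ₀ : 0 ≤ θ₀) (hθ : 0 ≤ θ) {Λ : Set (Fin d → ℤ)} (hΛ : Λ ⊆ Ω) (k : ℕ) (p q : K d N) :
    |cov C Δ Λ k p q| ≤
      sandwichConst d N cC (deltaStar d N γ (sandwichConst d N cC δ * c₀) (δ / 2)) *
        convConst d N γ (sandwichConst d N cC δ * c₀) (δ / 2) (sandwichConst d N cC δ * θ₀) *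
        Real.exp (-(deltaStar d N γ (sandwichConst d N cC δ * c₀) (δ / 2) / 2 * dist p.1 q.1)) :=
  (convC_cov h hδ hN hcC hc₀ hγ hθ₀ hθ hΛ).1 k p q

/-- The STEP clause of `convC_cov`, displayed: the η-rate of the covariance family with the supplier's `θ`. -/
theorem cov_step (h : CovInput Ω C Δ cC c₀ δ γ θ₀ θ) (hδ : 0 < δ) (hN : 0 < N) (hcC : 0 < cC) (hc₀ : 0 < c₀)
    (hγ : 0 < γ) (hθ₀ : 0 ≤ θ₀) (hθ : 0 ≤ θ) {Λ : Set (Fin d → ℤ)} (hΛ : Λ ⊆ Ω) (k : ℕ) (p q : K d N) :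
    |cov C Δ Λ (k + 1) p q - cov C Δ Λ k p q| ≤
      sandwichConst d N cC (deltaStar d N γ (sandwichConst d N cC δ * c₀) (δ / 2)) *
        convConst d N γ (sandwichConst d N cC δ * c₀) (δ / 2) (sandwichConst d N cC δ * θ₀) * θ ^ k *
        Real.exp (-(deltaStar d N γ (sandwichConst d N cC δ * c₀) (δ / 2) / 2 * dist p.1 q.1)) :=
  (convC_cov h hδ hN hcC hc₀ hγ hθ₀ hθ hΛ).2 k p q

end End

end

end Summit.QuantumFields.BalabanUV.Beta.GAN24.DirichletExhaustionCovariance
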